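import Summits.QuantumFields.BalabanUV.Beta.FP.EndpointOfRoad
import Summits.QuantumFields.BalabanUV.Beta.HessKerConvCKPlug
import Summits.QuantumFields.BalabanUV.Beta.GAN24.KSlotAssembly

/-!
# `BalabanUV.Beta.FP.RoadFromSlots` — road «FP» for binder row D1, THE ROAD's END WITH THE (CONV-C) BINDERS CUT DOWN TO THE S- AND W-SLOTS
# (`d = 3`, every `Lc ≥ 2`, adopted units `(sfStep Lc, smStep 3 Lc)`): the nine limit-currency binders of `FP/PerfectObjectsT.d1Drift_JsBalOf_of_perfect_step_law_bounded`
# / `FP/EndpointOfRoad.endpointExistence_of_perfect_step_law_bounded` are REPLACED by the S-slot Cauchy rows (`hS`, `hSall`, any rate `θS ∈ [0,1)`, decay `δS > 0`) and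
# the W-slot Cauchy rows (`hW`, `hWall`, `θW`, `δW`) ALONE — the K-rows come from gan24's END `GAN24.KSlotAssembly.convCKWall_holds` (p204341), the rate / window
# merge from asym1's `HessKerConvCKPlug.exists_merged_rows`, and the limit-currency shapes from asym1's closure lemmas (`decays_limMKerOf`, …) at the PERFECT
# objects (`KPerf_one` / `SPerfOf_one` / `WPerfOf_one`), BY NAME

HONEST FRAMING (cell contract, verbatim): «discharging `BetaPertH` makes Bałaban's UV stability UNCONDITIONAL — a real constructive-QFT result; it is NOT the
continuum limit and NOT the Clay problem.»  THIS MODULE DISCHARGES NOTHING of the wall beyond what `convCKWall_holds` already gives: the S- and W-slot rows (row G-an2-4,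
an2's (P4)), the `m = 1` pins, the STEP LAW of the perfect coefficient family (leaves N1/N2a/N2b/N3/N5; `StepLawAssembly.fPerf_succ_of_fubini(_flip)` is its
socket) and its LEADING-LOG ASYMPTOTICS (leaf N7) remain HYPOTHESES, displayed.  HEADLINE DISCIPLINE: «road FP's END needs, from row G-an2-4, only the S- and
W-slot Cauchy rows» — NOT «D1 closed», NOT «G-an2-4 closed», NOT BetaPertH, NOT continuum, NOT Clay; 0 wall binders instantiated at a value.  Claim table
`HOME/b2b-balaban-beta-d1-p3/LEAVES-FP.md` rows END / N10 (unit `b2b-balaban-beta-d1-formalise-leaf-06`).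
ABSOLUTE RULE (cell, verbatim): «No internally-minted statement may enter as a cited fact. Every hypothesis is either kernel-proved in this package or a verbatim
quotation of a PUBLISHED theorem with page reference.»  Nothing is cited; no `def … : Prop`; every input is a tree theorem imported BY NAME.

CONTENT (all [our object]; `d = 3`, `2 ≤ Lc`).
* `exists_limit_rows_of_slots` — from the S- and W-slot Cauchy rows: ONE rate `θ ∈ [0,1)`, ONE window `R`, and the NINE limit-currency binders of the road's END at the
  perfect triple `(KPerf …1, SPerfOf …1, WPerfOf …1)` in the adopted units (K-rows: `convCKWall_holds`; merge: `exists_merged_rows`; closure: `decays_limMKerOf` /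
  `decays_sub_limMKerOf` / `locStencil_(sub_)limStOf` / `vertexFamily₂_(sub_)limTabOf`; identification of the limits: `KPerf_one`, `SPerfOf_one`, `WPerfOf_one`).
* **`d1Drift_JsBalOf_of_slots_step_law_bounded`** / **`_littleO`**: S- and W-slot rows + pins + (STEP) + (ASYMP) ⊢ `D1Drift Lc (JsBalOf …) N μ ν`.
* **`endpointExistence_of_slots_step_law_bounded`**: the cell's END statement `EndpointExistence Cn` from the same + hβ + (D4) + (C) + hgen (`FP/EndpointOfRoad` BY NAME).
-/

namespace Summit.QuantumFields.BalabanUV.Beta.FP.RoadFromSlots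

open Filter Topology
open Literature.MathematicalPhysics.QuantumFieldTheory
open Literature.MathematicalPhysics.QuantumFieldTheory.Balaban1983to89
open Literature.MathematicalPhysics.QuantumFieldTheory.Balaban1983to89.Beta
open ExpKernelCalculus (MKer Decays VertexFamily₂)
open OneStepResolventKernel (Fib LocStencil)
open OneStepKernelFamily (KInvStep TbalOf D1Drift)
open BalabanStepJetsSucc (JsBal0Of JsBalOf)
open B12Normalization (stepBal)
open FlowStep FlowStepRuns DagBinding
open Literature.MathematicalPhysics.QuantumFieldTheory.Balaban1983to89.Beta.RemainderChain (RemainderConst)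
open HessKerDressedLimit (limMKerOf limStOf limTabOf decays_limMKerOf decays_sub_limMKerOf locStencil_limStOf locStencil_sub_limStOf
  vertexFamily₂_limTabOf vertexFamily₂_sub_limTabOf)
open Summit.QuantumFields.BalabanUV.Beta.HessKerDressedUnits (unitK unitS unitW)
open Summit.QuantumFields.BalabanUV.Beta.HessKerConvCKPlug (exists_merged_rows)
open Summit.QuantumFields.BalabanUV.Beta.GAN24.CombesThomas (sfStep smStep sfStep_ne_zero smStep_ne_zero)
open Summit.QuantumFields.BalabanUV.Beta.GAN24.KSlotAssembly (convCKWall_holds)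
open Summit.QuantumFields.BalabanUV.Beta.FP.PerfectObjectsT (KPerf KPerf_one SPerfOf SPerfOf_one WPerfOf WPerfOf_one fPerf
  d1Drift_JsBalOf_of_perfect_step_law_bounded d1Drift_JsBalOf_of_perfect_step_law_littleO)
open Summit.QuantumFields.BalabanUV.Beta.FP.EndpointOfRoad (endpointExistence_of_perfect_step_law_bounded)

noncomputable section

variable {Lc : ℕ} [NeZero Lc] (hLc : 1 ≤ Lc) (cE cVH cΛ : ℝ)
  (W : ℕ → Fin (3 + 1) → (Fin (3 + 1) → ℤ) → Fin (3 + 1) → (Fin (3 + 1) → ℤ) → MKer (3 + 1) (Fib 3))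
  (Cw' δw : ℕ → ℝ) (hδw : ∀ j, 0 < δw j) (hW' : ∀ j, VertexFamily₂ (W j) Lc (Cw' j) (δw j))
  (S : ℕ → ℕ → Fin (3 + 1) → (Fin (3 + 1) → ℤ) → MKer (3 + 1) (Fib 3))
  (Wt : ℕ → ℕ → Fin (3 + 1) → (Fin (3 + 1) → ℤ) → Fin (3 + 1) → (Fin (3 + 1) → ℤ) → MKer (3 + 1) (Fib 3))
  {Cs cS δS θS Cw cW δW θW : ℝ}

/-- [our object] **THE NINE LIMIT-CURRENCY BINDERS OF THE ROAD's END AT THE PERFECT TRIPLE, FROM THE S- and W-SLOT CAUCHY ROWS ALONE** (`d = 3`, `2 ≤ Lc`, adopted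
units): one rate `θ ∈ [0,1)`, one window `0 < R < δK`, `R/2 < δS`, `R < δW`, and `(hK, hKinf, hKrate, hS, hSinf, hSrate, hW, hWinf, hWrate)` with
`K∞ := KPerf Lc (sfStep Lc) (smStep 3 Lc) 1`, `S∞ := SPerfOf … S 1`, `W∞ := WPerfOf … Wt 1`. -/
theorem exists_limit_rows_of_slots (hLc2 : 2 ≤ Lc)
    (hS1 : ∀ j, S j 1 = (JsBal0Of hLc cE cVH cΛ W Cw' δw hδw hW' j).S) (hW1 : ∀ j, Wt j 1 = W j)
    (hS : ∀ j, LocStencil (unitS (sfStep Lc j) (smStep 3 Lc j) (JsBal0Of hLc cE cVH cΛ W Cw' δw hδw hW' j).S) Cs δS)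
    (hSall : ∀ k j, LocStencil (unitS (sfStep Lc (k + j)) (smStep 3 Lc (k + j)) (JsBal0Of hLc cE cVH cΛ W Cw' δw hδw hW' (k + j)).S -
      unitS (sfStep Lc k) (smStep 3 Lc k) (JsBal0Of hLc cE cVH cΛ W Cw' δw hδw hW' k).S) (cS * θS ^ k) δS)
    (hW : ∀ j, VertexFamily₂ (unitW (sfStep Lc j) (smStep 3 Lc j) (W j)) Lc Cw δW)
    (hWall : ∀ k j, VertexFamily₂ (unitW (sfStep Lc (k + j)) (smStep 3 Lc (k + j)) (W (k + j)) - unitW (sfStep Lc k) (smStep 3 Lc k) (W k)) Lc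
      (cW * θW ^ k) δW)
    (hδS : 0 < δS) (hδW : 0 < δW) (hθS0 : 0 ≤ θS) (hθS1 : θS < 1) (hθW0 : 0 ≤ θW) (hθW1 : θW < 1) :
    ∃ C δK cK θ R : ℝ, 0 < R ∧ R < δK ∧ R / 2 < δS ∧ R < δW ∧ 0 ≤ θ ∧ θ < 1 ∧
      (∀ j, Decays (unitK (sfStep Lc j) (smStep 3 Lc j) (KInvStep (d := 3) Lc j)) C δK) ∧
      Decays (KPerf (d := 3) Lc (sfStep Lc) (smStep 3 Lc) 1) C δK ∧
      (∀ j, Decays (unitK (sfStep Lc j) (smStep 3 Lc j) (KInvStep (d := 3) Lc j) - KPerf (d := 3) Lc (sfStep Lc) (smStep 3 Lc) 1) (cK * θ ^ j) δK) ∧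
      LocStencil (SPerfOf (sfStep Lc) (smStep 3 Lc) S 1) Cs δS ∧
      (∀ j, LocStencil (unitS (sfStep Lc j) (smStep 3 Lc j) (JsBal0Of hLc cE cVH cΛ W Cw' δw hδw hW' j).S - SPerfOf (sfStep Lc) (smStep 3 Lc) S 1)
        (cS * θ ^ j) δS) ∧
      VertexFamily₂ (WPerfOf (sfStep Lc) (smStep 3 Lc) Wt 1) Lc Cw δW ∧
      (∀ j, VertexFamily₂ (unitW (sfStep Lc j) (smStep 3 Lc j) (W j) - WPerfOf (sfStep Lc) (smStep 3 Lc) Wt 1) Lc (cW * θ ^ j) δW) := by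
  obtain ⟨C, δK, cK, θ, R, hR, hRK, hRS, hRW, hθ0, hθ1, hK, hKall, hSall', hWall'⟩ :=
    exists_merged_rows (Lc := Lc) (convCKWall_holds hLc2)
      (S := fun j => unitS (sfStep Lc j) (smStep 3 Lc j) (JsBal0Of hLc cE cVH cΛ W Cw' δw hδw hW' j).S)
      (W := fun j => unitW (sfStep Lc j) (smStep 3 Lc j) (W j)) hSall hWall hδS hδW hθS0 hθS1 hθW0 hθW1
  have hKinf := decays_limMKerOf hK hKall hθ1
  have hKrate := decays_sub_limMKerOf (K := fun j => unitK (sfStep Lc j) (smStep 3 Lc j) (KInvStep (d := 3) Lc j)) hKall hθ1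
  have hSinf := locStencil_limStOf hS hSall' hθ1
  have hSrate := locStencil_sub_limStOf
    (S := fun j => unitS (sfStep Lc j) (smStep 3 Lc j) (JsBal0Of hLc cE cVH cΛ W Cw' δw hδw hW' j).S) hSall' hθ1
  have hWinf := vertexFamily₂_limTabOf hW hWall' hθ1
  have hWrate := vertexFamily₂_sub_limTabOf (W := fun j => unitW (sfStep Lc j) (smStep 3 Lc j) (W j)) hWall' hθ1
  rw [← KPerf_one (d := 3) Lc (sfStep Lc) (smStep 3 Lc)] at hKinf hKrate
  rw [← SPerfOf_one (sfStep Lc) (smStep 3 Lc) hS1] at hSinf hSrate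
  rw [← WPerfOf_one (sfStep Lc) (smStep 3 Lc) hW1] at hWinf hWrate
  exact ⟨C, δK, cK, θ, R, hR, by linarith, hRS, hRW, hθ0, hθ1, hK, hKinf, hKrate, hSinf, hSrate, hWinf, hWrate⟩

/-- **ROAD «FP», THE END WITH (CONV-C) CUT DOWN TO THE S- AND W-SLOTS (bounded-defect form)** (`d = 3`, `2 ≤ Lc`, adopted units): the S-slot Cauchy rows, the
W-slot Cauchy rows, the `m = 1` pins, the STEP LAW of the perfect coefficient family and its LEADING-LOG ASYMPTOTICS with bounded defect ⊢ the wall literal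
`D1Drift Lc (JsBalOf …) N μ ν`.  [our object] -/
theorem d1Drift_JsBalOf_of_slots_step_law_bounded (hLc2 : 2 ≤ Lc)
    (hS1 : ∀ j, S j 1 = (JsBal0Of hLc cE cVH cΛ W Cw' δw hδw hW' j).S) (hW1 : ∀ j, Wt j 1 = W j)
    (hS : ∀ j, LocStencil (unitS (sfStep Lc j) (smStep 3 Lc j) (JsBal0Of hLc cE cVH cΛ W Cw' δw hδw hW' j).S) Cs δS)
    (hSall : ∀ k j, LocStencil (unitS (sfStep Lc (k + j)) (smStep 3 Lc (k + j)) (JsBal0Of hLc cE cVH cΛ W Cw' δw hδw hW' (k + j)).S -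
      unitS (sfStep Lc k) (smStep 3 Lc k) (JsBal0Of hLc cE cVH cΛ W Cw' δw hδw hW' k).S) (cS * θS ^ k) δS)
    (hW : ∀ j, VertexFamily₂ (unitW (sfStep Lc j) (smStep 3 Lc j) (W j)) Lc Cw δW)
    (hWall : ∀ k j, VertexFamily₂ (unitW (sfStep Lc (k + j)) (smStep 3 Lc (k + j)) (W (k + j)) - unitW (sfStep Lc k) (smStep 3 Lc k) (W k)) Lc
      (cW * θW ^ k) δW)
    (hδS : 0 < δS) (hδW : 0 < δW) (hθS0 : 0 ≤ θS) (hθS1 : θS < 1) (hθW0 : 0 ≤ θW) (hθW1 : θW < 1) (μ ν : Fin 4) {N Cg : ℝ}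
    (hstep : ∀ m : ℕ, 1 ≤ m → fPerf Lc (sfStep Lc) (smStep 3 Lc) S Wt μ ν (m + 1) =
      fPerf Lc (sfStep Lc) (smStep 3 Lc) S Wt μ ν m + fPerf Lc (sfStep Lc) (smStep 3 Lc) S Wt μ ν 1)
    (hasym : ∀ m : ℕ, 1 ≤ m → |fPerf Lc (sfStep Lc) (smStep 3 Lc) S Wt μ ν m - (m : ℝ) * stepBal N Lc| ≤ Cg) :
    D1Drift Lc (JsBalOf hLc cE cVH cΛ W Cw' δw hδw hW') N μ ν := by
  obtain ⟨C, δK, cK, θ, R, hR, hRK, hRS, hRW, hθ0, hθ1, hK, hKinf, hKrate, hSinf, hSrate, hWinf, hWrate⟩ :=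
    exists_limit_rows_of_slots hLc cE cVH cΛ W Cw' δw hδw hW' S Wt hLc2 hS1 hW1 hS hSall hW hWall hδS hδW hθS0 hθS1 hθW0 hθW1
  exact d1Drift_JsBalOf_of_perfect_step_law_bounded hLc cE cVH cΛ W Cw' δw hδw hW' (sfStep Lc) (smStep 3 Lc) S Wt sfStep_ne_zero smStep_ne_zero
    hS1 hW1 hK hKinf hKrate hS hSinf hSrate hW hWinf hWrate hR hRK hRS hRW hθ0 hθ1 μ ν hstep hasym

/-- **ROAD «FP», THE END WITH (CONV-C) CUT DOWN TO THE S- AND W-SLOTS (mean-law form)**: as above with the asymptotic input weakened to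
`(fPerf m − m·stepBal N Lc)/m → 0`.  [our object] -/
theorem d1Drift_JsBalOf_of_slots_step_law_littleO (hLc2 : 2 ≤ Lc)
    (hS1 : ∀ j, S j 1 = (JsBal0Of hLc cE cVH cΛ W Cw' δw hδw hW' j).S) (hW1 : ∀ j, Wt j 1 = W j)
    (hS : ∀ j, LocStencil (unitS (sfStep Lc j) (smStep 3 Lc j) (JsBal0Of hLc cE cVH cΛ W Cw' δw hδw hW' j).S) Cs δS)
    (hSall : ∀ k j, LocStencil (unitS (sfStep Lc (k + j)) (smStep 3 Lc (k + j)) (JsBal0Of hLc cE cVH cΛ W Cw' δw hδw hW' (k + j)).S -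
      unitS (sfStep Lc k) (smStep 3 Lc k) (JsBal0Of hLc cE cVH cΛ W Cw' δw hδw hW' k).S) (cS * θS ^ k) δS)
    (hW : ∀ j, VertexFamily₂ (unitW (sfStep Lc j) (smStep 3 Lc j) (W j)) Lc Cw δW)
    (hWall : ∀ k j, VertexFamily₂ (unitW (sfStep Lc (k + j)) (smStep 3 Lc (k + j)) (W (k + j)) - unitW (sfStep Lc k) (smStep 3 Lc k) (W k)) Lc
      (cW * θW ^ k) δW)
    (hδS : 0 < δS) (hδW : 0 < δW) (hθS0 : 0 ≤ θS) (hθS1 : θS < 1) (hθW0 : 0 ≤ θW) (hθW1 : θW < 1) (μ ν : Fin 4) {N : ℝ}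
    (hstep : ∀ m : ℕ, 1 ≤ m → fPerf Lc (sfStep Lc) (smStep 3 Lc) S Wt μ ν (m + 1) =
      fPerf Lc (sfStep Lc) (smStep 3 Lc) S Wt μ ν m + fPerf Lc (sfStep Lc) (smStep 3 Lc) S Wt μ ν 1)
    (hasym : Tendsto (fun m : ℕ => (fPerf Lc (sfStep Lc) (smStep 3 Lc) S Wt μ ν m - (m : ℝ) * stepBal N Lc) / (m : ℝ)) atTop (𝓝 0)) :
    D1Drift Lc (JsBalOf hLc cE cVH cΛ W Cw' δw hδw hW') N μ ν := by
  obtain ⟨C, δK, cK, θ, R, hR, hRK, hRS, hRW, hθ0, hθ1, hK, hKinf, hKrate, hSinf, hSrate, hWinf, hWrate⟩ :=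
    exists_limit_rows_of_slots hLc cE cVH cΛ W Cw' δw hδw hW' S Wt hLc2 hS1 hW1 hS hSall hW hWall hδS hδW hθS0 hθS1 hθW0 hθW1
  exact d1Drift_JsBalOf_of_perfect_step_law_littleO hLc cE cVH cΛ W Cw' δw hδw hW' (sfStep Lc) (smStep 3 Lc) S Wt sfStep_ne_zero smStep_ne_zero
    hS1 hW1 hK hKinf hKrate hS hSinf hSrate hW hWinf hWrate hR hRK hRS hRW hθ0 hθ1 μ ν hstep hasym

/-- **THE CELL's END STATEMENT FROM ROAD «FP» WITH (CONV-C) CUT DOWN TO THE S- AND W-SLOTS**: `EndpointExistence Cn` BY TYPE from the S- and W-slot rows, the pins, the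
perfect family's STEP LAW and bounded-defect ASYMPTOTICS, `hβ` (the one-loop split is the wall family's second moment), (D4) `RemainderConst` with `rr ≤ stepBal`, (C),
and `hgen` — `FP/EndpointOfRoad.endpointExistence_of_perfect_step_law_bounded` BY NAME.  [our object] -/
theorem endpointExistence_of_slots_step_law_bounded (hLc2 : 2 ≤ Lc)
    (hS1 : ∀ j, S j 1 = (JsBal0Of hLc cE cVH cΛ W Cw' δw hδw hW' j).S) (hW1 : ∀ j, Wt j 1 = W j)
    (hS : ∀ j, LocStencil (unitS (sfStep Lc j) (smStep 3 Lc j) (JsBal0Of hLc cE cVH cΛ W Cw' δw hδw hW' j).S) Cs δS)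
    (hSall : ∀ k j, LocStencil (unitS (sfStep Lc (k + j)) (smStep 3 Lc (k + j)) (JsBal0Of hLc cE cVH cΛ W Cw' δw hδw hW' (k + j)).S -
      unitS (sfStep Lc k) (smStep 3 Lc k) (JsBal0Of hLc cE cVH cΛ W Cw' δw hδw hW' k).S) (cS * θS ^ k) δS)
    (hW : ∀ j, VertexFamily₂ (unitW (sfStep Lc j) (smStep 3 Lc j) (W j)) Lc Cw δW)
    (hWall : ∀ k j, VertexFamily₂ (unitW (sfStep Lc (k + j)) (smStep 3 Lc (k + j)) (W (k + j)) - unitW (sfStep Lc k) (smStep 3 Lc k) (W k)) Lc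
      (cW * θW ^ k) δW)
    (hδS : 0 < δS) (hδW : 0 < δW) (hθS0 : 0 ≤ θS) (hθS1 : θS < 1) (hθW0 : 0 ≤ θW) (hθW1 : θW < 1) (μ ν : Fin 4) {N Cg : ℝ}
    (hstep : ∀ m : ℕ, 1 ≤ m → fPerf Lc (sfStep Lc) (smStep 3 Lc) S Wt μ ν (m + 1) =
      fPerf Lc (sfStep Lc) (smStep 3 Lc) S Wt μ ν m + fPerf Lc (sfStep Lc) (smStep 3 Lc) S Wt μ ν 1)
    (hasym : ∀ m : ℕ, 1 ≤ m → |fPerf Lc (sfStep Lc) (smStep 3 Lc) S Wt μ ν m - (m : ℝ) * stepBal N Lc| ≤ Cg)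
    {β : HBeta} {Cn : B12.Construction} (hgen : ForwardGenerated Cn β) (Sβ : B12Beta.OneLoopSplit β)
    (hβ : ∀ j, Sβ.β0 j = B12Beta.secondMoment (TbalOf Lc (JsBalOf hLc cE cVH cΛ W Cw' δw hδw hW') j) μ ν)
    {rr γ₀ : ℝ} (hγ₀ : 0 < γ₀) (hrem : RemainderConst Sβ γ₀ rr) (hr : rr ≤ stepBal N Lc) (hcont : BetaContH γ₀ β) :
    EndpointExistence Cn := by
  obtain ⟨C, δK, cK, θ, R, hR, hRK, hRS, hRW, hθ0, hθ1, hK, hKinf, hKrate, hSinf, hSrate, hWinf, hWrate⟩ :=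
    exists_limit_rows_of_slots hLc cE cVH cΛ W Cw' δw hδw hW' S Wt hLc2 hS1 hW1 hS hSall hW hWall hδS hδW hθS0 hθS1 hθW0 hθW1
  exact endpointExistence_of_perfect_step_law_bounded hLc cE cVH cΛ W Cw' δw hδw hW' (sfStep Lc) (smStep 3 Lc) S Wt sfStep_ne_zero smStep_ne_zero
    hS1 hW1 hK hKinf hKrate hS hSinf hSrate hW hWinf hWrate hR hRK hRS hRW hθ0 hθ1 μ ν hstep hasym hgen Sβ hβ hγ₀ hrem hr hcont

end

end Summit.QuantumFields.BalabanUV.Beta.FP.RoadFromSlots
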